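/-
Copyright: the b2b-balaban T⁴-continuum CRUX team, row NE7b leaf lineage `t4-ne7b-formalise-leaf-04` (gen 149). Project licence.
-/
import Summits.QuantumFields.BalabanUV.T4Continuum.Spine.NE7b.BlockPoincareFibreFloor
import Literature.MathematicalPhysics.QuantumFieldTheory.Balaban1983to89.B4Ineq115Torus

/-!
# THE THREE LETTERS ARE THE TREE's: `…BlockPoincareFibreFloor`'s engine, fed with `B4Ineq115Torus`'s own witness identity (`form_Drs`),
# block-Poincaré letter (`block_poincare` + Jensen) and next-average contraction (`form_EA_nonneg_le`), re-proves [B4] (1.15)'s lower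
# bound for Bałaban's scalar torus tower — `γ‖ψ‖² ≤ ⟨ψ, (aL⁻²Q^*Q + Δ^{(j)})ψ⟩` — with the SHARPER constant
# `γ⁻¹ = (1 + √(a∕min{8,a}))²∕a_j + 2L²∕min{8,a}` (the tree's: `(4L² + 4a∕a_j)∕min{8,a} + 2∕a_j`), and level-free with `a(1 − L⁻²)`
# (row NE7b, node U5c; a JUNCTION certificate — nothing new of print's; [folklore] + the tree's KERNEL lemmas BY NAME)

Cell `pub-balaban`, sub-cell `t4`, spine estimate NE7b (`T4WeightBudget.RelWeightBound`; NOT PRINTED, NOT PROVED).  Crux-route work under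
`Spine/NE7b/` by leaf-04.  PURPOSE: the refuter's ι-BPFF-2 (PRICING v107 F552) and the chair's reading say WHERE the multi-scale content of
`…BlockPoincareFibreFloor` (BPFF) sits — in the three letters, «true only in suitably scaled level norms; the tree's `B4Ineq115Torus` does
exactly this for the scalar torus».  THIS FILE certifies that sentence in the kernel: the three letters ARE inhabited by the tree's scalar
tower objects with LEVEL-FREE constants `p = L²∕min{8,a}`, `κ = √(a∕min{8,a})`, `q = 1`, `a′ = aL⁻²`, `A = a_j = B1.aSeq a L j`, and BPFF's
real engine `sq_le_of_chain` then returns (1.15)'s lower bound — an independent second proof of the tree's `ineq115_lower` with a constant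
sharper by the optimised Cauchy–Schwarz weights (zero weight by value: (1.15) was already a theorem).  Nothing of Bałaban's is asserted:
every input is a KERNEL theorem of `B4Ineq115Torus` ∕ `B5Leaf237C0Torus` ∕ `B1RG242Torus` ∕ `B1`.

WHAT IS PROVED:
* §1 dot-product plumbing ([folklore]): `dot_le_sqrt_mul_sqrt` (Cauchy–Schwarz `(u⬝v)² ≤ (u⬝u)(v⬝v)` inlined — the tree's
  `B9Thm311.dot_sq_le`), `sqrt_dot_add_le` (`√((u+v)⬝(u+v)) ≤ √(u⬝u) + √(v⬝v)`); `√(x + y) ≤ √x + √y` is inlined at its one use.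
* §2 **`ineq115_lower_threeResistors`** — for `P : Params`, `0 < a`, `0 ≤ m²`, `1 ≤ j`, every `ψ`:
  `((1 + 1·√(a∕min{8,a}))²∕a_j + L²∕min{8,a} + (√(a∕min{8,a}))²∕(aL⁻²))⁻¹·(ψ⬝ψ) ≤ ψ⬝(Carg ψ)` — BPFF's `Γ` VERBATIM at the tree's letters;
  `ineq115_lower_threeResistors'` (the same constant simplified to `((1 + √(a∕min{8,a}))²∕a_j + 2L²∕min{8,a})⁻¹`);
  **`ineq115_lower_threeResistors_uniform`** (level-free: `a_j` replaced by `a(1 − L⁻²)`, via BPFF's `floorConst_mono` + `B1.ainf_lt_aSeq`).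

NOT HERE: anything new about print; the gauge road (NE9's `B5Eq190FlatCoercivityUniform` ∕ `B9Eq323TowerBlockPoincare` are the flat-background
letters there — not instantiated).  BY-NAME EFFECT ON THE WALL: NONE.  NE7b NOT PRINTED ∕ NOT PROVED; spine PROVED 0∕9; rung (B)+1 on a FINITE
torus — NOT infinite volume, NOT the mass gap, NOT Clay.  HONEST DEPENDENCY: continuum YM on T⁴ ⇐ BetaPertH ∧ nine spine estimates (0/9 proved);
BetaPertH ⇐ (D1) ∧ (D4) ∧ CAP+tail; G-an2-4 gates asym, D1 and NE2∕3∕4.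
-/

set_option autoImplicit false

noncomputable section

namespace Summit.QuantumFields.BalabanUV.T4Continuum.NE7b.BlockPoincareFibreFloorScalarTower

open Matrix
open Literature.MathematicalPhysics.QuantumFieldTheory.Balaban1983to89
open Literature.MathematicalPhysics.QuantumFieldTheory.Balaban1983to89.B1RG242Torus
open Literature.MathematicalPhysics.QuantumFieldTheory.Balaban1983to89.B5Display136Torus
open Literature.MathematicalPhysics.QuantumFieldTheory.Balaban1983to89.B5Leaf237C0Torus
open Literature.MathematicalPhysics.QuantumFieldTheory.Balaban1983to89.B4Ineq115Torus
open Summit.QuantumFields.BalabanUV.T4Continuum.NE7b.BlockPoincareFibreFloor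

/-! ## §1 Dot-product plumbing -/

section Dot

variable {ι : Type*} [Fintype ι]

/-- `u ⬝ v ≤ √(u ⬝ u)·√(v ⬝ v)`. [folklore] -/
theorem dot_le_sqrt_mul_sqrt (u v : ι → ℝ) : u ⬝ᵥ v ≤ Real.sqrt (u ⬝ᵥ u) * Real.sqrt (v ⬝ᵥ v) := by
  have hu : 0 ≤ u ⬝ᵥ u := dot_self_nonneg u
  -- Cauchy–Schwarz `(u ⬝ v)² ≤ (u ⬝ u)(v ⬝ v)` (the tree's `B9Thm311.dot_sq_le`, inlined to keep the import cone)
  have hcs : (u ⬝ᵥ v) ^ 2 ≤ (u ⬝ᵥ u) * (v ⬝ᵥ v) := by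
    simpa only [dotProduct, sq] using Finset.sum_mul_sq_le_sq_mul_sq Finset.univ u v
  rw [← Real.sqrt_mul hu]
  exact Real.le_sqrt_of_sq_le hcs

/-- The dot-product triangle inequality in square-root currency: `√((u+v)⬝(u+v)) ≤ √(u⬝u) + √(v⬝v)`. [folklore] -/
theorem sqrt_dot_add_le (u v : ι → ℝ) :
    Real.sqrt ((u + v) ⬝ᵥ (u + v)) ≤ Real.sqrt (u ⬝ᵥ u) + Real.sqrt (v ⬝ᵥ v) := by
  have hu : 0 ≤ u ⬝ᵥ u := dot_self_nonneg u
  have hv : 0 ≤ v ⬝ᵥ v := dot_self_nonneg v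
  have hrhs : 0 ≤ Real.sqrt (u ⬝ᵥ u) + Real.sqrt (v ⬝ᵥ v) := by positivity
  rw [Real.sqrt_le_left hrhs]
  have e : (u + v) ⬝ᵥ (u + v) = u ⬝ᵥ u + v ⬝ᵥ v + 2 * (u ⬝ᵥ v) := by
    rw [add_dotProduct, dotProduct_add, dotProduct_add, dotProduct_comm v u]; ring
  rw [e, add_sq, Real.sq_sqrt hu, Real.sq_sqrt hv]
  nlinarith [dot_le_sqrt_mul_sqrt u v]

end Dot

/-! ## §2 (1.15)'s lower bound from BPFF's engine at the tree's three letters -/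

variable (P : Params)

/-- **[B4] (1.15), LOWER BOUND, BY THREE RESISTANCES IN SERIES**: for Bałaban's scalar torus tower (`P : Params`, `0 < a`, `0 ≤ m²`,
level `1 ≤ j`) and every `ψ : Site P j → ℝ`,
`((1 + 1·κ)²∕a_j + L²∕min{8,a} + κ²∕(aL⁻²))⁻¹ · (ψ ⬝ ψ) ≤ ψ ⬝ (Carg P a m² j) ψ`, `κ = √(a∕min{8,a})`, `a_j = B1.aSeq a L j` — the engine
`…BlockPoincareFibreFloor.sq_le_of_chain` at the letters: ONE BIG STEP = `form_Drs` (witness `φ₀ = phi0 … ψ`), block Poincaré with the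
next constraint = `block_poincare` on the fine torus with the composite blocks + Jensen `avg_sq_le` (`min{8,a}‖Q_jφ₀‖² ≤ L²·S + a·q`),
next-average contraction `q = 1` = `form_EA_nonneg_le`. [folklore junction; every input a tree KERNEL theorem] -/
theorem ineq115_lower_threeResistors {a msq : ℝ} (ha : 0 < a) (hm : 0 ≤ msq) {j : ℕ} (hj : 1 ≤ j) (ψ : Site P j → ℝ) :
    ((1 + 1 * Real.sqrt (a / min 8 a)) ^ 2 / B1.aSeq a P.L j + (P.L : ℝ) ^ 2 / min 8 a
        + Real.sqrt (a / min 8 a) ^ 2 / (a * ((P.L : ℝ) ^ 2)⁻¹))⁻¹ * (ψ ⬝ᵥ ψ)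
      ≤ ψ ⬝ᵥ (Carg P a msq j *ᵥ ψ) := by
  -- the tree's letters (as in `B4Ineq115Torus.ineq115_lower`)
  have hLr := one_lt_cast_L P
  have hA : 0 < B1.aSeq a P.L j := B1.aSeq_pos ha hLr hj
  have hmin : 0 < min 8 a := lt_min (by norm_num) ha
  have hL0 : (0 : ℝ) < (P.L : ℝ) ^ 2 := by positivity
  have hw := wj_pos P j
  have hw' : 0 < (((P.L : ℝ) ^ P.d)⁻¹) ^ stepExp P j := pow_pos (inv_pos.mpr (pow_pos P.cast_L_pos _)) _
  set A : ℝ := B1.aSeq a P.L j with hAdef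
  set φ₀ := phi0 P a msq j ψ with hφ₀
  set g := Qk P j *ᵥ φ₀ with hg
  set PP := Qs P j * Q P j with hPP0
  set S : ℝ := wj P j * (φ₀ ⬝ᵥ (hOp P 0 (P.eps / P.spacing j) (P.spacing j ^ 2 * msq) *ᵥ φ₀)) with hS
  set r : ℝ := (g - ψ) ⬝ᵥ (g - ψ) with hr
  set p : ℝ := ψ ⬝ᵥ (PP *ᵥ ψ) with hp
  set q : ℝ := g ⬝ᵥ (PP *ᵥ g) with hq
  set G : ℝ := g ⬝ᵥ g with hG
  set N : ℝ := ψ ⬝ᵥ ψ with hN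
  set D : ℝ := ∑ μ, (deriv P 0 1 μ *ᵥ φ₀) ⬝ᵥ (deriv P 0 1 μ *ᵥ φ₀) with hDdef
  -- (i) ONE BIG STEP: the witness identity
  have hE : ψ ⬝ᵥ (Carg P a msq j *ᵥ ψ) = a * ((P.L : ℝ) ^ 2)⁻¹ * p + (S + A * r) := by
    rw [Carg, Matrix.add_mulVec, dotProduct_add, Matrix.smul_mulVec, dotProduct_smul, smul_eq_mul, form_Drs ha hm hj]
  have hS0 : 0 ≤ S := mul_nonneg hw.le (form_hOp_nonneg _ (by positivity) _)
  have hr0 : 0 ≤ r := dot_self_nonneg _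
  have hG0 : 0 ≤ G := dot_self_nonneg _
  have hN0 : 0 ≤ N := dot_self_nonneg _
  have hp01 := form_EA_nonneg_le P (sitesPerDir_eq_succ P j) ψ
  rw [← QsQ_eq] at hp01
  have hp0 : 0 ≤ p := hp01.1
  have hq01 := form_EA_nonneg_le P (sitesPerDir_eq_succ P j) g
  rw [← QsQ_eq] at hq01
  have hq0 : 0 ≤ q := hq01.1
  -- (ii) BLOCK POINCARÉ WITH THE NEXT CONSTRAINT: `min{8,a}·G ≤ L²S + a q` (the tree's chain verbatim)
  have bp := block_poincare P (sitesPerDir_zero_eq P (j + 1)) a φ₀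
  rw [← QksQk_eq'] at bp
  have comp : wj P j * (φ₀ ⬝ᵥ ((Qks P (j + 1) * Qk P (j + 1)) *ᵥ φ₀)) = q := wj_form_EA_succ j φ₀
  have hD0 : 0 ≤ D := Finset.sum_nonneg fun μ _ => dot_self_nonneg _
  have hSD : wj P j * (((P.L : ℝ) ^ j) ^ 2 * D) ≤ S := by
    rw [hS, form_hOp_spacing, ← hDdef]
    refine mul_le_mul_of_nonneg_left ?_ hw.le
    have : 0 ≤ P.spacing j ^ 2 * msq * (φ₀ ⬝ᵥ φ₀) := mul_nonneg (by positivity) (dot_self_nonneg _)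
    linarith
  have hlv := pow_lvl_succ_sq_le (P := P) j
  have hJ : G ≤ wj P j * (φ₀ ⬝ᵥ φ₀) := avg_sq_le P (sitesPerDir_zero_eq P j) φ₀
  have hmain : min 8 a * G ≤ (P.L : ℝ) ^ 2 * S + a * q := by
    have h1 : min 8 a * G ≤ min 8 a * (wj P j * (φ₀ ⬝ᵥ φ₀)) := mul_le_mul_of_nonneg_left hJ hmin.le
    have h2 : wj P j * (min 8 a * (φ₀ ⬝ᵥ φ₀))
        ≤ wj P j * (((P.L : ℝ) ^ lvl P (j + 1)) ^ 2 * D + a * (φ₀ ⬝ᵥ ((Qks P (j + 1) * Qk P (j + 1)) *ᵥ φ₀))) :=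
      mul_le_mul_of_nonneg_left bp hw.le
    have h3 : wj P j * (((P.L : ℝ) ^ lvl P (j + 1)) ^ 2 * D) ≤ (P.L : ℝ) ^ 2 * S := by
      calc wj P j * (((P.L : ℝ) ^ lvl P (j + 1)) ^ 2 * D)
          ≤ wj P j * ((P.L : ℝ) ^ 2 * ((P.L : ℝ) ^ j) ^ 2 * D) :=
            mul_le_mul_of_nonneg_left (mul_le_mul_of_nonneg_right hlv hD0) hw.le
        _ = (P.L : ℝ) ^ 2 * (wj P j * (((P.L : ℝ) ^ j) ^ 2 * D)) := by ring
        _ ≤ (P.L : ℝ) ^ 2 * S := mul_le_mul_of_nonneg_left hSD hL0.le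
    have h4 : wj P j * (((P.L : ℝ) ^ lvl P (j + 1)) ^ 2 * D + a * (φ₀ ⬝ᵥ ((Qks P (j + 1) * Qk P (j + 1)) *ᵥ φ₀)))
        = wj P j * (((P.L : ℝ) ^ lvl P (j + 1)) ^ 2 * D) + a * q := by rw [mul_add, ← comp]; ring
    have h5 : min 8 a * (wj P j * (φ₀ ⬝ᵥ φ₀)) = wj P j * (min 8 a * (φ₀ ⬝ᵥ φ₀)) := by ring
    linarith
  -- the chain in square-root currency
  set κ : ℝ := Real.sqrt (a / min 8 a) with hκ
  have hκ0 : 0 ≤ κ := Real.sqrt_nonneg _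
  have hκsq : κ ^ 2 = a / min 8 a := Real.sq_sqrt (div_nonneg ha.le hmin.le)
  -- n ≤ t₁ + ρ : `√N ≤ √r + √G`
  have hn : Real.sqrt N ≤ Real.sqrt r + Real.sqrt G := by
    have e : ψ = (ψ - g) + g := by abel
    have er : (ψ - g) ⬝ᵥ (ψ - g) = r := by
      rw [hr, show ψ - g = -(g - ψ) by abel, neg_dotProduct, dotProduct_neg, neg_neg]
    calc Real.sqrt N = Real.sqrt (((ψ - g) + g) ⬝ᵥ ((ψ - g) + g)) := by rw [hN, ← e]
      _ ≤ Real.sqrt ((ψ - g) ⬝ᵥ (ψ - g)) + Real.sqrt (g ⬝ᵥ g) := sqrt_dot_add_le _ _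
      _ = Real.sqrt r + Real.sqrt G := by rw [er, hG]
  -- ρ ≤ √(p_letter·b) + κ·T : `√G ≤ √((L²∕min{8,a})·S) + κ·√q`
  have hρ : Real.sqrt G ≤ Real.sqrt ((P.L : ℝ) ^ 2 / min 8 a * S) + κ * Real.sqrt q := by
    have hG' : G ≤ (P.L : ℝ) ^ 2 / min 8 a * S + a / min 8 a * q := by
      rw [div_mul_eq_mul_div, div_mul_eq_mul_div, ← add_div, le_div_iff₀ hmin]; linarith
    calc Real.sqrt G ≤ Real.sqrt ((P.L : ℝ) ^ 2 / min 8 a * S + a / min 8 a * q) := Real.sqrt_le_sqrt hG'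
      _ ≤ Real.sqrt ((P.L : ℝ) ^ 2 / min 8 a * S) + Real.sqrt (a / min 8 a * q) := by
          -- `√(x + y) ≤ √x + √y` (inlined; the tree has it under several names)
          have hx : 0 ≤ (P.L : ℝ) ^ 2 / min 8 a * S := by positivity
          have hy : 0 ≤ a / min 8 a * q := mul_nonneg (div_nonneg ha.le hmin.le) hq0
          rw [Real.sqrt_le_left (by positivity), add_sq, Real.sq_sqrt hx, Real.sq_sqrt hy]
          nlinarith [Real.sqrt_nonneg ((P.L : ℝ) ^ 2 / min 8 a * S), Real.sqrt_nonneg (a / min 8 a * q)]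
      _ = Real.sqrt ((P.L : ℝ) ^ 2 / min 8 a * S) + κ * Real.sqrt q := by
          rw [Real.sqrt_mul (div_nonneg ha.le hmin.le), hκ]
  -- T ≤ q·t₁ + t₄ : `√q ≤ 1·√r + √p` (the next average is a contraction: `form_EA_nonneg_le`, and linear)
  have hT : Real.sqrt q ≤ 1 * Real.sqrt r + Real.sqrt p := by
    set w : ℝ := (((P.L : ℝ) ^ P.d)⁻¹) ^ stepExp P j with hwdef
    set Av := avgMat P j (j + 1) (stepExp P j) w with hAv
    have hPP : PP = extMat P j (j + 1) (stepExp P j) * Av := by rw [hPP0, QsQ_eq]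
    have fq : q = w⁻¹ * ((Av *ᵥ g) ⬝ᵥ (Av *ᵥ g)) := by rw [hq, hPP, form_EA P hw'.ne']
    have fp : p = w⁻¹ * ((Av *ᵥ ψ) ⬝ᵥ (Av *ᵥ ψ)) := by rw [hp, hPP, form_EA P hw'.ne']
    have fr : (g - ψ) ⬝ᵥ (PP *ᵥ (g - ψ)) = w⁻¹ * ((Av *ᵥ (g - ψ)) ⬝ᵥ (Av *ᵥ (g - ψ))) := by rw [hPP, form_EA P hw'.ne']
    have hrr := (form_EA_nonneg_le P (sitesPerDir_eq_succ P j) (g - ψ)).2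
    rw [← QsQ_eq, ← hPP0] at hrr
    have hw0 : 0 ≤ w⁻¹ := inv_nonneg.mpr hw'.le
    have lin : Av *ᵥ g = Av *ᵥ (g - ψ) + Av *ᵥ ψ := by rw [← Matrix.mulVec_add, sub_add_cancel]
    have tri : Real.sqrt ((Av *ᵥ g) ⬝ᵥ (Av *ᵥ g))
        ≤ Real.sqrt ((Av *ᵥ (g - ψ)) ⬝ᵥ (Av *ᵥ (g - ψ))) + Real.sqrt ((Av *ᵥ ψ) ⬝ᵥ (Av *ᵥ ψ)) := by
      rw [lin]; exact sqrt_dot_add_le _ _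
    have hsw : 0 ≤ Real.sqrt w⁻¹ := Real.sqrt_nonneg _
    calc Real.sqrt q = Real.sqrt w⁻¹ * Real.sqrt ((Av *ᵥ g) ⬝ᵥ (Av *ᵥ g)) := by rw [fq, Real.sqrt_mul hw0]
      _ ≤ Real.sqrt w⁻¹ * (Real.sqrt ((Av *ᵥ (g - ψ)) ⬝ᵥ (Av *ᵥ (g - ψ))) + Real.sqrt ((Av *ᵥ ψ) ⬝ᵥ (Av *ᵥ ψ))) :=
          mul_le_mul_of_nonneg_left tri hsw
      _ = Real.sqrt ((g - ψ) ⬝ᵥ (PP *ᵥ (g - ψ))) + Real.sqrt p := by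
          rw [mul_add, ← Real.sqrt_mul hw0, ← Real.sqrt_mul hw0, ← fr, ← fp]
      _ ≤ 1 * Real.sqrt r + Real.sqrt p := by
          rw [one_mul]; exact add_le_add (Real.sqrt_le_sqrt hrr) le_rfl
  -- BPFF's engine
  have key := sq_le_of_chain (A := A) (a' := a * ((P.L : ℝ) ^ 2)⁻¹) (p := (P.L : ℝ) ^ 2 / min 8 a) (κ := κ) (q := 1)
    hA (by positivity) (by positivity) hκ0 (Real.sqrt_nonneg N) hS0 hn hρ hT
  rw [Real.sq_sqrt hN0, Real.sq_sqrt hr0, Real.sq_sqrt hp0] at key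
  have hΓ : 0 < (1 + 1 * κ) ^ 2 / A + (P.L : ℝ) ^ 2 / min 8 a + κ ^ 2 / (a * ((P.L : ℝ) ^ 2)⁻¹) := by
    have : 0 < 1 + 1 * κ := by positivity
    positivity
  rw [hE, inv_mul_le_iff₀ hΓ]
  linarith

/-- The same floor with the constant SIMPLIFIED: `((1 + √(a∕min{8,a}))²∕a_j + 2L²∕min{8,a})⁻¹·(ψ⬝ψ) ≤ ψ⬝(Carg ψ)` — against the tree's
`gamma115 L a a_j = ((4L² + 4a∕a_j)∕min{8,a} + 2∕a_j)⁻¹` this is sharper (the tree splits `(s+t)² ≤ 2s² + 2t²` twice). [folklore] -/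
theorem ineq115_lower_threeResistors' {a msq : ℝ} (ha : 0 < a) (hm : 0 ≤ msq) {j : ℕ} (hj : 1 ≤ j) (ψ : Site P j → ℝ) :
    ((1 + Real.sqrt (a / min 8 a)) ^ 2 / B1.aSeq a P.L j + 2 * (P.L : ℝ) ^ 2 / min 8 a)⁻¹ * (ψ ⬝ᵥ ψ)
      ≤ ψ ⬝ᵥ (Carg P a msq j *ᵥ ψ) := by
  have h := ineq115_lower_threeResistors P ha hm hj ψ
  have hmin : 0 < min 8 a := lt_min (by norm_num) ha
  have hL0 : (0 : ℝ) < (P.L : ℝ) ^ 2 := pow_pos (lt_trans one_pos (one_lt_cast_L P)) 2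
  have hκsq : Real.sqrt (a / min 8 a) ^ 2 = a / min 8 a := Real.sq_sqrt (div_nonneg ha.le hmin.le)
  have e : (1 + 1 * Real.sqrt (a / min 8 a)) ^ 2 / B1.aSeq a P.L j + (P.L : ℝ) ^ 2 / min 8 a
      + Real.sqrt (a / min 8 a) ^ 2 / (a * ((P.L : ℝ) ^ 2)⁻¹)
      = (1 + Real.sqrt (a / min 8 a)) ^ 2 / B1.aSeq a P.L j + 2 * (P.L : ℝ) ^ 2 / min 8 a := by
    rw [hκsq, one_mul]
    field_simp
    ring
  rw [e] at h
  exact h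

/-- **LEVEL-FREE**: `((1 + √(a∕min{8,a}))²∕(a(1 − L⁻²)) + 2L²∕min{8,a})⁻¹·(ψ⬝ψ) ≤ ψ⬝(Carg ψ)` for EVERY `j ≥ 1` — BPFF's `floorConst_mono` with
`a(1 − L⁻²) < a_j` (`B1.ainf_lt_aSeq`). [folklore junction] -/
theorem ineq115_lower_threeResistors_uniform {a msq : ℝ} (ha : 0 < a) (hm : 0 ≤ msq) {j : ℕ} (hj : 1 ≤ j) (ψ : Site P j → ℝ) :
    ((1 + Real.sqrt (a / min 8 a)) ^ 2 / (a * (1 - ((P.L : ℝ) ^ 2)⁻¹)) + 2 * (P.L : ℝ) ^ 2 / min 8 a)⁻¹ * (ψ ⬝ᵥ ψ)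
      ≤ ψ ⬝ᵥ (Carg P a msq j *ᵥ ψ) := by
  have hLr := one_lt_cast_L P
  have hmin : 0 < min 8 a := lt_min (by norm_num) ha
  have hainf : 0 < a * (1 - ((P.L : ℝ) ^ 2)⁻¹) := by
    have h2 : 1 < (P.L : ℝ) ^ 2 := by nlinarith
    have : ((P.L : ℝ) ^ 2)⁻¹ < 1 := inv_lt_one_of_one_lt₀ h2
    exact mul_pos ha (by linarith)
  have hle : a * (1 - ((P.L : ℝ) ^ 2)⁻¹) ≤ B1.aSeq a P.L j := (B1.ainf_lt_aSeq ha hLr j hj).le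
  have h1 : 0 < 1 + Real.sqrt (a / min 8 a) := by positivity
  have hmono : ((1 + Real.sqrt (a / min 8 a)) ^ 2 / (a * (1 - ((P.L : ℝ) ^ 2)⁻¹)) + 2 * (P.L : ℝ) ^ 2 / min 8 a)⁻¹
      ≤ ((1 + Real.sqrt (a / min 8 a)) ^ 2 / B1.aSeq a P.L j + 2 * (P.L : ℝ) ^ 2 / min 8 a)⁻¹ := by
    have hd : (1 + Real.sqrt (a / min 8 a)) ^ 2 / B1.aSeq a P.L j ≤ (1 + Real.sqrt (a / min 8 a)) ^ 2 / (a * (1 - ((P.L : ℝ) ^ 2)⁻¹)) :=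
      div_le_div_of_nonneg_left (by positivity) hainf hle
    have hApos : 0 < B1.aSeq a P.L j := B1.aSeq_pos ha hLr hj
    have hpos : 0 < (1 + Real.sqrt (a / min 8 a)) ^ 2 / B1.aSeq a P.L j + 2 * (P.L : ℝ) ^ 2 / min 8 a :=
      add_pos_of_pos_of_nonneg (div_pos (by positivity) hApos) (by positivity)
    exact inv_anti₀ hpos (by linarith)
  exact (mul_le_mul_of_nonneg_right hmono (dot_self_nonneg ψ)).trans (ineq115_lower_threeResistors' P ha hm hj ψ)

end Summit.QuantumFields.BalabanUV.T4Continuum.NE7b.BlockPoincareFibreFloorScalarTower
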